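import Summits.Ventures.Crystal3D.Theorems.StickyWulffConstantGenericWallFloorCommonSlots
import Summits.Ventures.Crystal3D.Theorems.StickyWulffConstantGenericWallFloorMixedDozenRules
import HarnessLib

/-!
# Step gain of monotone Barlow lines: after a steep arrival, the best twin capper still rises

HONEST FRAMING. Part of the venture `Summits/Ventures/Crystal3D` (cell `crystal3d-full`), helper for the
crux `GenericWallFloor` (stmt-Ventures-19480) of `route-Ventures-StickyWulffConstant`, REGISTERED line
`WallLedgerG` (planner cf-p1 gen 16), stub `stub_twoSlabAdhesion : TwoSlabAdhesion` (THE CRUX of the line).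
Brick N1 of the general-filling architecture «monotone Barlow lines» (memo GENERAL-FILLING-ARCH on the item):
a slot line of the grain climbs with the steepest slot `u` (`⟪A u, e₃⟫ ≥ √2/2`, `exists_steep_slot`); where
it is twin-capped (`exit_twinCap_of_patch`: layer normal `n` with `⟪A u, n⟫ = √(2/3)`, cappers
`e − A w + 2⟪A w, n⟫ n` over the three far slots `w`) the line continues through the best-rising capper.
This file proves that such a step still RISES by a fixed amount, so lines are monotone in height:

* `inner_ge_seventh_of_steep_across` — unit `a, n, z` with `⟪a, n⟫ = √(2/3)` and `⟪a, z⟫ ≥ √2/2` force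
  `⟪n, z⟫ ≥ 1/7` (exact bound `(√2 − 1)/√6 ≈ 0.169`; Cauchy–Schwarz orthogonally to `a`);
* `inner_eq_half_of_far_slots` — two distinct slots on the far side of a layer plane (`⟪A w, n⟫ =
  ⟪A w', n⟫ = √(2/3)`) are adjacent: `⟪A w, A w'⟫ = 1/2`;
* `sum_eq_sqrt_six_smul` — three unit vectors at `60°` from each other and at `35.26°` from the unit
  vector `n` (`⟪cᵢ, n⟫ = √(2/3)`) sum to `√6 • n` (equality case of Cauchy–Schwarz, by a norm computation);
* `exists_inner_ge_third_sum` — one of three reals is at least a third of their sum;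
* `exists_capper_rise` — COROLLARY: with three distinct far slots, some capper direction
  `c = −A w + 2√(2/3) n` has `⟪c, z⟫ ≥ (√6/3)·⟪n, z⟫ ≥ 1/9`.

WHAT THIS IS NOT: vector algebra only; nothing about packings; F-C1 not moved.
-/

noncomputable section

namespace Summit.Ventures.Crystal3D.Theorems

open Summit.Ventures.Crystal3D
open Literature.MathematicalPhysics.StatisticalMechanics (fccStacking)
open scoped InnerProductSpace

/-- `√(2/3)² = 2/3` and `4/5 < √(2/3)`. -/
theorem sqrt_twoThirds_facts : Real.sqrt (2 / 3) ^ 2 = 2 / 3 ∧ (4 / 5 : ℝ) < Real.sqrt (2 / 3) := by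
  have h : Real.sqrt (2 / 3) ^ 2 = 2 / 3 := Real.sq_sqrt (by norm_num)
  refine ⟨h, ?_⟩
  nlinarith [Real.sqrt_nonneg (2 / 3), h]

/-- **Steep arrival tilts the layer normal upward.**  For unit vectors `a, n, z` with
`⟪a, n⟫ = √(2/3)` (the arrival slot crosses the layer plane) and `⟪a, z⟫ ≥ √2/2` (the slot is steep),
`⟪n, z⟫ ≥ 1/7` (the exact bound is `(√2 − 1)/√6`). -/
theorem inner_ge_seventh_of_steep_across (a n z : EuclideanSpace ℝ (Fin 3)) (ha : ‖a‖ = 1)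
    (hn : ‖n‖ = 1) (hz : ‖z‖ = 1) (han : ⟪a, n⟫_ℝ = Real.sqrt (2 / 3))
    (haz : Real.sqrt 2 / 2 ≤ ⟪a, z⟫_ℝ) : (1 / 7 : ℝ) ≤ ⟪n, z⟫_ℝ := by
  obtain ⟨hα2, -⟩ := sqrt_twoThirds_facts
  have haa : ⟪a, a⟫_ℝ = 1 := by rw [real_inner_self_eq_norm_sq, ha, one_pow]
  have hnn : ⟪n, n⟫_ℝ = 1 := by rw [real_inner_self_eq_norm_sq, hn, one_pow]
  have hzz : ⟪z, z⟫_ℝ = 1 := by rw [real_inner_self_eq_norm_sq, hz, one_pow]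
  have hna : ⟪n, a⟫_ℝ = Real.sqrt (2 / 3) := by rw [real_inner_comm, han]
  have hza : ⟪z, a⟫_ℝ = ⟪a, z⟫_ℝ := real_inner_comm _ _
  -- Cauchy–Schwarz for the components orthogonal to `a`
  have hCS := real_inner_mul_inner_self_le (n - Real.sqrt (2 / 3) • a) (z - ⟪a, z⟫_ℝ • a)
  have h1 : ⟪n - Real.sqrt (2 / 3) • a, z - ⟪a, z⟫_ℝ • a⟫_ℝ = ⟪n, z⟫_ℝ - Real.sqrt (2 / 3) * ⟪a, z⟫_ℝ := by
    simp only [inner_sub_left, inner_sub_right, inner_smul_left, inner_smul_right, hna, haa,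
      RCLike.conj_to_real]
    ring
  have h2 : ⟪n - Real.sqrt (2 / 3) • a, n - Real.sqrt (2 / 3) • a⟫_ℝ = 1 / 3 := by
    simp only [inner_sub_left, inner_sub_right, inner_smul_left, inner_smul_right, hna, han, haa, hnn,
      RCLike.conj_to_real]
    nlinarith [hα2]
  have h3 : ⟪z - ⟪a, z⟫_ℝ • a, z - ⟪a, z⟫_ℝ • a⟫_ℝ = 1 - ⟪a, z⟫_ℝ ^ 2 := by
    simp only [inner_sub_left, inner_sub_right, inner_smul_left, inner_smul_right, hza, haa, hzz,
      RCLike.conj_to_real]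
    ring
  rw [h1, h2, h3] at hCS
  -- numerics: `s := ⟪a, z⟫ ≥ √2/2`, so `s² ≥ 1/2`; `(√(2/3) s)² ≥ 1/3`
  have hs2 : Real.sqrt 2 ^ 2 = 2 := Real.sq_sqrt (by norm_num)
  have hspos : 0 < ⟪a, z⟫_ℝ := lt_of_lt_of_le (by positivity) haz
  have hs_sq : 1 / 2 ≤ ⟪a, z⟫_ℝ ^ 2 := by nlinarith [haz, hs2, Real.sqrt_nonneg 2]
  have hαs_pos : 0 < Real.sqrt (2 / 3) * ⟪a, z⟫_ℝ := by positivity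
  have hαs_sq : 1 / 3 ≤ (Real.sqrt (2 / 3) * ⟪a, z⟫_ℝ) ^ 2 := by nlinarith [hα2, hs_sq]
  have hαs : 4 / 7 < Real.sqrt (2 / 3) * ⟪a, z⟫_ℝ := by nlinarith [hαs_sq, hαs_pos]
  by_contra hlt
  push Not at hlt
  have hd : 3 / 7 < Real.sqrt (2 / 3) * ⟪a, z⟫_ℝ - ⟪n, z⟫_ℝ := by linarith
  have hd2 : 9 / 49 < (Real.sqrt (2 / 3) * ⟪a, z⟫_ℝ - ⟪n, z⟫_ℝ) ^ 2 := by nlinarith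
  nlinarith [hCS, hs_sq, hd2]

/-- **Two far slots are adjacent.**  Unit vectors `a, b` of a moved fcc lattice with the same layer
component `⟪a, n⟫ = ⟪b, n⟫ = √(2/3)` (`n` unit) and `a ≠ b` have `⟪a, b⟫ = 1/2`. -/
theorem inner_eq_half_of_far_slots (A : EuclideanSpace ℝ (Fin 3) ≃ₗᵢ[ℝ] EuclideanSpace ℝ (Fin 3))
    {a b n : EuclideanSpace ℝ (Fin 3)} (ha : a ∈ A '' fccStacking 1 (Real.sqrt (2 / 3)))
    (hb : b ∈ A '' fccStacking 1 (Real.sqrt (2 / 3))) (ha1 : ‖a‖ = 1) (hb1 : ‖b‖ = 1) (hn : ‖n‖ = 1)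
    (han : ⟪a, n⟫_ℝ = Real.sqrt (2 / 3)) (hbn : ⟪b, n⟫_ℝ = Real.sqrt (2 / 3)) (hab : a ≠ b) :
    ⟪a, b⟫_ℝ = 1 / 2 := by
  obtain ⟨hα2, -⟩ := sqrt_twoThirds_facts
  -- Cauchy–Schwarz on `a + b` against `n`: `⟪a, b⟫ ≥ 1/3`
  have hsum : ⟪a + b, n⟫_ℝ = 2 * Real.sqrt (2 / 3) := by rw [inner_add_left, han, hbn]; ring
  have hCS := real_inner_mul_inner_self_le (a + b) n
  have haa : ⟪a, a⟫_ℝ = 1 := by rw [real_inner_self_eq_norm_sq, ha1, one_pow]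
  have hbb : ⟪b, b⟫_ℝ = 1 := by rw [real_inner_self_eq_norm_sq, hb1, one_pow]
  have hnn : ⟪n, n⟫_ℝ = 1 := by rw [real_inner_self_eq_norm_sq, hn, one_pow]
  have hpp : ⟪a + b, a + b⟫_ℝ = 2 + 2 * ⟪a, b⟫_ℝ := by
    rw [inner_add_left, inner_add_right, inner_add_right, haa, hbb, real_inner_comm a b]; ring
  rw [hsum, hpp, hnn] at hCS
  have hge : 1 / 3 ≤ ⟪a, b⟫_ℝ := by nlinarith [hα2]
  -- the five possible values
  rcases inner_mem_of_unit_slots A ha hb ha1 hb1 with h | h | h | h | h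
  · -- `⟪a, b⟫ = 1` forces `a = b`
    exfalso; apply hab
    have : ‖a - b‖ ^ 2 = 0 := by
      rw [← real_inner_self_eq_norm_sq, inner_sub_left, inner_sub_right, inner_sub_right, haa, hbb,
        real_inner_comm a b, h]; ring
    have : ‖a - b‖ = 0 := by nlinarith [norm_nonneg (a - b)]
    exact sub_eq_zero.1 (norm_eq_zero.1 this)
  · exact h
  · rw [h] at hge; norm_num at hge
  · rw [h] at hge; norm_num at hge
  · rw [h] at hge; norm_num at hge

/-- **Three cappers sum to `√6 n`.**  Three unit vectors, pairwise at inner product `1/2`, each with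
`⟪cᵢ, n⟫ = √(2/3)` for a unit vector `n`, satisfy `c₁ + c₂ + c₃ = √6 • n`. -/
theorem sum_eq_sqrt_six_smul (c₁ c₂ c₃ n : EuclideanSpace ℝ (Fin 3)) (h₁ : ‖c₁‖ = 1) (h₂ : ‖c₂‖ = 1)
    (h₃ : ‖c₃‖ = 1) (hn : ‖n‖ = 1) (h₁₂ : ⟪c₁, c₂⟫_ℝ = 1 / 2) (h₁₃ : ⟪c₁, c₃⟫_ℝ = 1 / 2)
    (h₂₃ : ⟪c₂, c₃⟫_ℝ = 1 / 2) (hn₁ : ⟪c₁, n⟫_ℝ = Real.sqrt (2 / 3)) (hn₂ : ⟪c₂, n⟫_ℝ = Real.sqrt (2 / 3))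
    (hn₃ : ⟪c₃, n⟫_ℝ = Real.sqrt (2 / 3)) : c₁ + c₂ + c₃ = Real.sqrt 6 • n := by
  have h62 : Real.sqrt 6 * Real.sqrt (2 / 3) = 2 := by
    rw [← Real.sqrt_mul (by norm_num), show (6 : ℝ) * (2 / 3) = 2 ^ 2 by norm_num,
      Real.sqrt_sq (by norm_num)]
  have h66 : Real.sqrt 6 * Real.sqrt 6 = 6 := Real.mul_self_sqrt (by norm_num)
  have c11 : ⟪c₁, c₁⟫_ℝ = 1 := by rw [real_inner_self_eq_norm_sq, h₁, one_pow]
  have c22 : ⟪c₂, c₂⟫_ℝ = 1 := by rw [real_inner_self_eq_norm_sq, h₂, one_pow]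
  have c33 : ⟪c₃, c₃⟫_ℝ = 1 := by rw [real_inner_self_eq_norm_sq, h₃, one_pow]
  have nn : ⟪n, n⟫_ℝ = 1 := by rw [real_inner_self_eq_norm_sq, hn, one_pow]
  have h₂₁ : ⟪c₂, c₁⟫_ℝ = 1 / 2 := by rw [real_inner_comm, h₁₂]
  have h₃₁ : ⟪c₃, c₁⟫_ℝ = 1 / 2 := by rw [real_inner_comm, h₁₃]
  have h₃₂ : ⟪c₃, c₂⟫_ℝ = 1 / 2 := by rw [real_inner_comm, h₂₃]
  set p : EuclideanSpace ℝ (Fin 3) := c₁ + c₂ + c₃ with hp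
  set q : EuclideanSpace ℝ (Fin 3) := Real.sqrt 6 • n with hq
  have hpp : ⟪p, p⟫_ℝ = 6 := by
    simp only [hp, inner_add_left, inner_add_right, c11, c22, c33, h₁₂, h₁₃, h₂₃, h₂₁, h₃₁, h₃₂]
    norm_num
  have hpq : ⟪p, q⟫_ℝ = Real.sqrt 6 * (3 * Real.sqrt (2 / 3)) := by
    rw [hq, inner_smul_right, hp, inner_add_left, inner_add_left, hn₁, hn₂, hn₃]; ring
  have hqp : ⟪q, p⟫_ℝ = Real.sqrt 6 * (3 * Real.sqrt (2 / 3)) := by rw [real_inner_comm, hpq]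
  have hqq : ⟪q, q⟫_ℝ = 6 := by
    rw [hq, inner_smul_left, inner_smul_right, nn]; simp [h66]
  have hmm : ⟪p - q, p - q⟫_ℝ = 0 := by
    rw [inner_sub_sub_self, hpp, hpq, hqp, hqq]
    nlinarith [h62]
  have : p - q = 0 := inner_self_eq_zero.1 hmm
  rwa [sub_eq_zero] at this

/-- One of three reals is at least a third of their sum. -/
theorem exists_ge_third_sum (x₁ x₂ x₃ : ℝ) :
    (x₁ + x₂ + x₃) / 3 ≤ x₁ ∨ (x₁ + x₂ + x₃) / 3 ≤ x₂ ∨ (x₁ + x₂ + x₃) / 3 ≤ x₃ := by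
  by_contra h
  push Not at h
  obtain ⟨h1, h2, h3⟩ := h
  linarith

/-- **The best capper rises.**  Data: the grain frame `A`, a unit layer normal `n`, the steep arrival
slot `u` (`⟪A u, n⟫ = √(2/3)`, `⟪A u, z⟫ ≥ √2/2` for the unit «vertical» `z`), and three distinct far
slots `w₁, w₂, w₃` (`⟪A wᵢ, n⟫ = √(2/3)`).  Then one of the three capper directions
`cᵢ = −A wᵢ + 2√(2/3) • n` rises by at least `1/9`: `⟪cᵢ, z⟫ ≥ (√6/3) ⟪n, z⟫ ≥ √6/21 > 1/9`. -/
theorem exists_capper_rise (A : EuclideanSpace ℝ (Fin 3) ≃ₗᵢ[ℝ] EuclideanSpace ℝ (Fin 3))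
    {n z u w₁ w₂ w₃ : EuclideanSpace ℝ (Fin 3)} (hn : ‖n‖ = 1) (hz : ‖z‖ = 1)
    (hu : u ∈ fccSlots) (hun : ⟪A u, n⟫_ℝ = Real.sqrt (2 / 3)) (huz : Real.sqrt 2 / 2 ≤ ⟪A u, z⟫_ℝ)
    (hw₁ : w₁ ∈ fccSlots) (hw₂ : w₂ ∈ fccSlots) (hw₃ : w₃ ∈ fccSlots)
    (h12 : w₁ ≠ w₂) (h13 : w₁ ≠ w₃) (h23 : w₂ ≠ w₃)
    (hn₁ : ⟪A w₁, n⟫_ℝ = Real.sqrt (2 / 3)) (hn₂ : ⟪A w₂, n⟫_ℝ = Real.sqrt (2 / 3))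
    (hn₃ : ⟪A w₃, n⟫_ℝ = Real.sqrt (2 / 3)) :
    ∃ w ∈ ({w₁, w₂, w₃} : Finset (EuclideanSpace ℝ (Fin 3))),
      (1 / 9 : ℝ) ≤ ⟪-A w + (2 * Real.sqrt (2 / 3)) • n, z⟫_ℝ := by
  obtain ⟨hα2, -⟩ := sqrt_twoThirds_facts
  have hnz : (1 / 7 : ℝ) ≤ ⟪n, z⟫_ℝ :=
    inner_ge_seventh_of_steep_across (A u) n z
      (by rw [LinearIsometryEquiv.norm_map, norm_eq_one_of_mem_fccSlots hu]) hn hz hun huz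
  -- the three capper directions
  have slotA : ∀ {w}, w ∈ fccSlots → A w ∈ A '' fccStacking 1 (Real.sqrt (2 / 3)) ∧ ‖A w‖ = 1 :=
    fun hw => ⟨⟨_, mem_fcc_of_mem_fccSlots hw, rfl⟩,
      by rw [LinearIsometryEquiv.norm_map, norm_eq_one_of_mem_fccSlots hw]⟩
  have nn : ⟪n, n⟫_ℝ = 1 := by rw [real_inner_self_eq_norm_sq, hn, one_pow]
  have cap_unit : ∀ {w}, w ∈ fccSlots → ⟪A w, n⟫_ℝ = Real.sqrt (2 / 3) →
      ‖-A w + (2 * Real.sqrt (2 / 3)) • n‖ = 1 := by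
    intro w hw hwn
    have hww : ⟪A w, A w⟫_ℝ = 1 := by rw [real_inner_self_eq_norm_sq, (slotA hw).2, one_pow]
    have hsq : ‖-A w + (2 * Real.sqrt (2 / 3)) • n‖ ^ 2 = 1 := by
      rw [← real_inner_self_eq_norm_sq]
      simp only [inner_add_left, inner_add_right, inner_neg_left, inner_neg_right, inner_smul_left,
        inner_smul_right, RCLike.conj_to_real, hww, nn, hwn, real_inner_comm (A w) n]
      nlinarith [hα2]
    nlinarith [norm_nonneg (-A w + (2 * Real.sqrt (2 / 3)) • n)]
  have cap_n : ∀ {w}, ⟪A w, n⟫_ℝ = Real.sqrt (2 / 3) →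
      ⟪-A w + (2 * Real.sqrt (2 / 3)) • n, n⟫_ℝ = Real.sqrt (2 / 3) := by
    intro w hwn
    rw [inner_add_left, inner_neg_left, inner_smul_left, hwn, nn]; simp; ring
  have cap_pair : ∀ {w w'}, w ∈ fccSlots → w' ∈ fccSlots → w ≠ w' → ⟪A w, n⟫_ℝ = Real.sqrt (2 / 3) →
      ⟪A w', n⟫_ℝ = Real.sqrt (2 / 3) →
      ⟪-A w + (2 * Real.sqrt (2 / 3)) • n, -A w' + (2 * Real.sqrt (2 / 3)) • n⟫_ℝ = 1 / 2 := by
    intro w w' hw hw' hne hwn hw'n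
    have hAne : A w ≠ A w' := fun h => hne (A.injective h)
    have hhalf := inner_eq_half_of_far_slots A (slotA hw).1 (slotA hw').1 (slotA hw).2 (slotA hw').2 hn
      hwn hw'n hAne
    simp only [inner_add_left, inner_add_right, inner_neg_left, inner_neg_right, inner_smul_left,
      inner_smul_right, RCLike.conj_to_real, hhalf, nn, hwn, hw'n, real_inner_comm (A w') n]
    nlinarith [hα2]
  have hsum := sum_eq_sqrt_six_smul _ _ _ n (cap_unit hw₁ hn₁) (cap_unit hw₂ hn₂) (cap_unit hw₃ hn₃) hn
    (cap_pair hw₁ hw₂ h12 hn₁ hn₂) (cap_pair hw₁ hw₃ h13 hn₁ hn₃) (cap_pair hw₂ hw₃ h23 hn₂ hn₃)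
    (cap_n hn₁) (cap_n hn₂) (cap_n hn₃)
  have hsumz : ⟪-A w₁ + (2 * Real.sqrt (2 / 3)) • n, z⟫_ℝ + ⟪-A w₂ + (2 * Real.sqrt (2 / 3)) • n, z⟫_ℝ +
      ⟪-A w₃ + (2 * Real.sqrt (2 / 3)) • n, z⟫_ℝ = Real.sqrt 6 * ⟪n, z⟫_ℝ := by
    rw [← inner_add_left, ← inner_add_left, hsum, inner_smul_left]; simp
  -- `√6/3 · 1/7 ≥ 1/9`
  have h6 : (2.4 : ℝ) < Real.sqrt 6 := by
    rw [show (2.4 : ℝ) = Real.sqrt (2.4 ^ 2) by rw [Real.sqrt_sq (by norm_num)]]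
    exact Real.sqrt_lt_sqrt (by norm_num) (by norm_num)
  have hthird : (1 / 9 : ℝ) ≤ Real.sqrt 6 * ⟪n, z⟫_ℝ / 3 := by nlinarith [hnz, h6]
  rcases exists_ge_third_sum (⟪-A w₁ + (2 * Real.sqrt (2 / 3)) • n, z⟫_ℝ)
      (⟪-A w₂ + (2 * Real.sqrt (2 / 3)) • n, z⟫_ℝ) (⟪-A w₃ + (2 * Real.sqrt (2 / 3)) • n, z⟫_ℝ) with
    h | h | h
  · exact ⟨w₁, by simp, by rw [hsumz] at h; linarith⟩
  · exact ⟨w₂, by simp, by rw [hsumz] at h; linarith⟩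
  · exact ⟨w₃, by simp, by rw [hsumz] at h; linarith⟩

end Summit.Ventures.Crystal3D.Theorems

end
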